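/-
Summits/MatrixMultiplication/MatrixMultiplication/Theorems/TetraResidualNecessityFamilies.lean
decomp-mm lens 6, generation 29 — supports item 27058 (TetraPlusTwo, declared residual of route
TetrahedronCarving).  Part 5: arbitrary multi-term families (critic g28 s2); equality cut (s1).
-/
import Summits.MatrixMultiplication.MatrixMultiplication.Theorems.TetraResidualNecessityCut

/-!
# Residual necessity, part 5: arbitrary families; the record cut is an equality cut

Parts 1–3 treat FINITE families of support-linear pieces `∑ j, coef_j · sval Δ u_j ≤ rhs`, part 4b
(`capFamily_forces_nearly_tight`) arbitrary families of ONE-TERM caps.  Here (critic g28, s2): the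
escape law for ARBITRARY index types of MULTI-TERM pieces, abstract carrier and `K₄`, quantitative.
* §10 `sval_union_pts_le`, `sval_union_singleton` (exact one-point update law
  `sval (Δ₀ ∪ {p}) u = max (sval Δ₀ u) ⟨u,p⟩`), `LinData.holds_union_of_slack` (fixed-`ε` form of
  `stable_of_slack`), `LinData.exists_nearlyTight_of_not_holds`, `LinData.slack_lt_of_not_holds`:
  a piece true at `Δ₀` that FAILS after adjoining the points `x_k + ε v_k` has a positive term seeing
  some `v_k` whose direction is `ε`-nearly tight at `x_k` (`⟨u_j,x_k⟩ ≤ sval Δ₀ u_j < ⟨u_j,x_k⟩ +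
  ε⟨u_j,v_k⟩`), and its slack at `Δ₀` is `< ε · ∑ j, coef_j⁺ · rise_j`.  `linFamily_exists_failure`,
  `linFamily_forces_nearly_tight`, `k4_linFamily_forces_nearly_tight`: ANY family `(D i)_{i ∈ I}` of
  pieces, each true at `Δ₀`, forcing `ω ≤ 2` has for every small `ε > 0` a member failing at the
  perturbed world — hence with an ω-seeing positive term `ε`-nearly tight at the exotic point and
  slack `< ε · ∑ j coef_j⁺ ⟨u_j,tri⟩⁺`.  Finite `I`: exact tightness (part 2); one-term caps: part 4b.
  Every residual-free body-semantic decomposition of `ω = 2`, finite or not, one-term or not,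
  accumulates tightness at the summit face: the residual is dissolved only in the limit.
* §11 (s1) `sval_k4pert` (`sval_ε u = max (sval₀ u) (⟨u,x₀⟩ + ε⟨u,tri⟩)`), the flat-world values
  `ω(2,1,2) = 4`, `ω = 2`, `ω(1,a,1) = 2` (`a ≤ 1`), and `recordCut_slack_flat`: at the flat world ALL
  THREE pieces of the cut of record (`ExcessZero : ω(K₄) ≤ ω(2,1,2)`, `PlusTwo : ω + 2 ≤ ω(K₄)`,
  `AlphaCap a : ω(1,a,1) ≤ 2`) hold with EQUALITY; what separates them is the directional gap at
  `x₀` (`gap_flat_x0`: `1/2` for `𝟙`, `2(1-a)/3` for `(a,1,1,0,0,0)`, `0` for `tri`), read off by the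
  update law: `ExcessZero` survives EVERY `ε` (`excessZero_holds_flat_pert`), `AlphaCap a` iff
  `ε (a+2) ≤ 2(1-a)/3` (`alphaCap_holds_flat_pert_iff`), `PlusTwo` breaks for every `ε > 0`
  (`plusTwo_not_holds_flat_pert`).

Pure convex geometry over `Mathlib`; no tensor input, no `sorry`, no new axiom, no instance, no notation.
-/

open Filter Topology Set

namespace Summit.MatrixMultiplication.MatrixMultiplication.Theorems.TetraResidualNecessity

/-! ### 10. Arbitrary families of multi-term pieces -/

section AbstractFamilies

variable {ι : Type*} [Fintype ι]

/-- the total rise rate of the direction `u` along the perturbation list: `∑_k ⟨u,v_k⟩⁺` -/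
noncomputable def rise (pert : List ((ι → ℝ) × (ι → ℝ))) (u : ι → ℝ) : ℝ :=
  (pert.map fun xv => max (dot u xv.2) 0).sum

/-- the rise rate is nonnegative -/
theorem rise_nonneg (pert : List ((ι → ℝ) × (ι → ℝ))) (u : ι → ℝ) : 0 ≤ rise pert u := by
  apply List.sum_nonneg
  intro x hx
  obtain ⟨xv, _, rfl⟩ := List.mem_map.1 hx
  exact le_max_right _ _

/-- each perturbation direction rises at most at the total rate -/
theorem dot_le_rise {pert : List ((ι → ℝ) × (ι → ℝ))} {xv : (ι → ℝ) × (ι → ℝ)} (h : xv ∈ pert)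
    (u : ι → ℝ) : dot u xv.2 ≤ rise pert u :=
  (le_max_left _ _).trans
    (List.single_le_sum (fun x hx => by
        obtain ⟨yv, _, rfl⟩ := List.mem_map.1 hx
        exact le_max_right _ _) _ (List.mem_map.2 ⟨xv, h, rfl⟩))

/-- **update bound**: adjoining the points `x_k + ε v_k` (base points dominated by `Δ₀`) raises a
support value by at most `ε · rise` -/
theorem sval_union_pts_le {Δ₀ : Set (ι → ℝ)} (hΔ : Tame Δ₀) (pert : List ((ι → ℝ) × (ι → ℝ)))
    (hx : ∀ xv ∈ pert, ∀ u, dot u xv.1 ≤ sval Δ₀ u) {ε : ℝ} (hε : 0 ≤ ε) (u : ι → ℝ) :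
    sval (Δ₀ ∪ pts pert ε) u ≤ sval Δ₀ u + ε * rise pert u := by
  apply sval_union_le hΔ
  · exact le_add_of_nonneg_right (mul_nonneg hε (rise_nonneg pert u))
  · intro p hp
    obtain ⟨xv, hxv, rfl⟩ := exists_of_mem_pts hp
    rw [dot_add_smul]
    have h1 := hx xv hxv u
    have h2 : ε * dot u xv.2 ≤ ε * rise pert u :=
      mul_le_mul_of_nonneg_left (dot_le_rise hxv u) hε
    linarith

/-- **the exact one-point update law**: adjoining one point takes the maximum -/
theorem sval_union_singleton {Δ₀ : Set (ι → ℝ)} (hΔ : Tame Δ₀) (u p : ι → ℝ) :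
    sval (Δ₀ ∪ {p}) u = max (sval Δ₀ u) (dot u p) := by
  unfold sval
  rw [image_union, image_singleton,
    csSup_union (hΔ.bdd u) (hΔ.nonempty.image _) bddAbove_singleton (singleton_nonempty _),
    csSup_singleton]

omit [Fintype ι] in
/-- the perturbation set of a single pair is a single point -/
theorem pts_singleton (x v : ι → ℝ) (ε : ℝ) : pts [(x, v)] ε = {x + ε • v} := by
  ext p
  simp [pts]

/-- fixed-`ε` form of part 1's `stable_of_slack`: a piece true at `Δ₀` all of whose
positive-coefficient terms seeing a perturbation are `ε`-slack at the base point survives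
adjoining the points `x_k + ε v_k` -/
theorem LinData.holds_union_of_slack (D : LinData ι) {Δ₀ : Set (ι → ℝ)} (hΔ : Tame Δ₀)
    (hnec : D.holds Δ₀) (pert : List ((ι → ℝ) × (ι → ℝ)))
    (hx : ∀ xv ∈ pert, ∀ u, dot u xv.1 ≤ sval Δ₀ u) {ε : ℝ} (hε : 0 ≤ ε)
    (hslack : ∀ xv ∈ pert, ∀ j, 0 < D.coef j → 0 < dot (D.dir j) xv.2 →
      dot (D.dir j) xv.1 + ε * dot (D.dir j) xv.2 ≤ sval Δ₀ (D.dir j)) :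
    D.holds (Δ₀ ∪ pts pert ε) := by
  unfold LinData.holds at hnec ⊢
  refine le_trans ?_ hnec
  apply Finset.sum_le_sum
  intro j _
  by_cases hj : 0 < D.coef j
  · apply mul_le_mul_of_nonneg_left _ hj.le
    apply sval_union_le hΔ le_rfl
    intro p hp
    obtain ⟨xv, hxv, rfl⟩ := exists_of_mem_pts hp
    rw [dot_add_smul]
    by_cases hv : 0 < dot (D.dir j) xv.2
    · exact hslack xv hxv j hj hv
    · push Not at hv
      have : ε * dot (D.dir j) xv.2 ≤ 0 := mul_nonpos_of_nonneg_of_nonpos hε hv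
      linarith [hx xv hxv (D.dir j)]
  · push Not at hj
    exact mul_le_mul_of_nonpos_left (sval_le_sval_union hΔ (pts_finite pert ε) _) hj

/-- **failure pins a nearly tight ω-seeing term**: a piece true at `Δ₀` failing after adjoining
the `x_k + ε v_k` has `coef_j > 0`, `⟨u_j,v_k⟩ > 0`, `⟨u_j,x_k⟩ ≤ sval Δ₀ u_j < ⟨u_j,x_k⟩ + ε ⟨u_j,v_k⟩`. -/
theorem LinData.exists_nearlyTight_of_not_holds (D : LinData ι) {Δ₀ : Set (ι → ℝ)}
    (hΔ : Tame Δ₀) (hnec : D.holds Δ₀) (pert : List ((ι → ℝ) × (ι → ℝ)))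
    (hx : ∀ xv ∈ pert, ∀ u, dot u xv.1 ≤ sval Δ₀ u) {ε : ℝ} (hε : 0 ≤ ε)
    (hfail : ¬ D.holds (Δ₀ ∪ pts pert ε)) :
    ∃ xv ∈ pert, ∃ j, 0 < D.coef j ∧ 0 < dot (D.dir j) xv.2 ∧
      dot (D.dir j) xv.1 ≤ sval Δ₀ (D.dir j) ∧
      sval Δ₀ (D.dir j) < dot (D.dir j) xv.1 + ε * dot (D.dir j) xv.2 := by
  by_contra h
  push Not at h
  exact hfail (D.holds_union_of_slack hΔ hnec pert hx hε
    (fun xv hxv j hj hv => h xv hxv j hj hv (hx xv hxv _)))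

/-- **failure bounds the slack.**  A piece that fails after adjoining the points `x_k + ε v_k`
(base points dominated by `Δ₀`) had slack `< ε · ∑ j, coef_j⁺ · rise_j` at `Δ₀`. -/
theorem LinData.slack_lt_of_not_holds (D : LinData ι) {Δ₀ : Set (ι → ℝ)} (hΔ : Tame Δ₀)
    (pert : List ((ι → ℝ) × (ι → ℝ)))
    (hx : ∀ xv ∈ pert, ∀ u, dot u xv.1 ≤ sval Δ₀ u) {ε : ℝ} (hε : 0 ≤ ε)
    (hfail : ¬ D.holds (Δ₀ ∪ pts pert ε)) :
    D.rhs - ∑ j, D.coef j * sval Δ₀ (D.dir j) <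
      ε * ∑ j, max (D.coef j) 0 * rise pert (D.dir j) := by
  unfold LinData.holds at hfail
  rw [not_le] at hfail
  have hterm : ∀ j, D.coef j * sval (Δ₀ ∪ pts pert ε) (D.dir j) ≤
      D.coef j * sval Δ₀ (D.dir j) + ε * (max (D.coef j) 0 * rise pert (D.dir j)) := by
    intro j
    by_cases hj : 0 < D.coef j
    · rw [max_eq_left hj.le]
      calc D.coef j * sval (Δ₀ ∪ pts pert ε) (D.dir j)
          ≤ D.coef j * (sval Δ₀ (D.dir j) + ε * rise pert (D.dir j)) :=
            mul_le_mul_of_nonneg_left (sval_union_pts_le hΔ pert hx hε (D.dir j)) hj.le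
        _ = D.coef j * sval Δ₀ (D.dir j) + ε * (D.coef j * rise pert (D.dir j)) := by ring
    · push Not at hj
      rw [max_eq_right hj, zero_mul, mul_zero, add_zero]
      exact mul_le_mul_of_nonpos_left (sval_le_sval_union hΔ (pts_finite pert ε) _) hj
  have hsum := Finset.sum_le_sum (fun j (_ : j ∈ Finset.univ) => hterm j)
  rw [Finset.sum_add_distrib, ← Finset.mul_sum] at hsum
  linarith

/-- **forcing families fail at the perturbed world**: if an arbitrary family forces the cap
`sval Δ t ≤ s` and a lawful perturbation has `⟨t,x_k⟩ = s`, `⟨t,v_k⟩ > 0`, some member fails. -/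
theorem linFamily_exists_failure {Δ₀ K : Set (ι → ℝ)} (hΔ : Tame Δ₀) (hK : Δ₀ ⊆ K)
    (pert : List ((ι → ℝ) × (ι → ℝ)))
    (hroom : ∀ xv ∈ pert, ∀ᶠ ε in 𝓝[>] (0 : ℝ), xv.1 + ε • xv.2 ∈ K)
    {t : ι → ℝ} {s : ℝ} {xv₀ : (ι → ℝ) × (ι → ℝ)} (hxv₀ : xv₀ ∈ pert) (ht : dot t xv₀.1 = s)
    (hv : 0 < dot t xv₀.2) {I : Type*} (D : I → LinData ι)
    (hF : ∀ Δ : Set (ι → ℝ), Δ₀ ⊆ Δ → Δ ⊆ K → (∀ i, (D i).holds Δ) → Cap t s Δ) :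
    ∀ᶠ ε in 𝓝[>] (0 : ℝ), ∃ i, ¬ (D i).holds (Δ₀ ∪ pts pert ε) := by
  filter_upwards [pts_room hroom, cap_fails hΔ pert hxv₀ ht hv] with ε hεK hcap
  by_contra h
  push Not at h
  exact hcap (hF _ subset_union_left (union_subset hK hεK) h)

/-- **Escape law for arbitrary families of multi-term pieces (abstract carrier).**  If an ARBITRARY
family `(D i)_{i ∈ I}` of support-linear pieces, each true at `Δ₀`, forces the cap `sval Δ t ≤ s`, and
a lawful perturbation `x_k + ε v_k` (base points dominated) has `⟨t,x_k⟩ = s`, `⟨t,v_k⟩ > 0`, then for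
every small `ε > 0` some member (i) fails at the perturbed world, (ii) has a positive term seeing
some `v_k'`, `ε`-nearly tight at `x_k'`, (iii) had slack `< ε · ∑ j coef_j⁺ rise_j` at `Δ₀`. -/
theorem linFamily_forces_nearly_tight {Δ₀ K : Set (ι → ℝ)} (hΔ : Tame Δ₀) (hK : Δ₀ ⊆ K)
    (pert : List ((ι → ℝ) × (ι → ℝ)))
    (hroom : ∀ xv ∈ pert, ∀ᶠ ε in 𝓝[>] (0 : ℝ), xv.1 + ε • xv.2 ∈ K)
    (hx : ∀ xv ∈ pert, ∀ u, dot u xv.1 ≤ sval Δ₀ u)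
    {t : ι → ℝ} {s : ℝ} {xv₀ : (ι → ℝ) × (ι → ℝ)} (hxv₀ : xv₀ ∈ pert) (ht : dot t xv₀.1 = s)
    (hv : 0 < dot t xv₀.2) {I : Type*} (D : I → LinData ι) (hnec : ∀ i, (D i).holds Δ₀)
    (hF : ∀ Δ : Set (ι → ℝ), Δ₀ ⊆ Δ → Δ ⊆ K → (∀ i, (D i).holds Δ) → Cap t s Δ) :
    ∀ᶠ ε in 𝓝[>] (0 : ℝ), ∃ i, ¬ (D i).holds (Δ₀ ∪ pts pert ε) ∧
      (∃ xv ∈ pert, ∃ j, 0 < (D i).coef j ∧ 0 < dot ((D i).dir j) xv.2 ∧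
        dot ((D i).dir j) xv.1 ≤ sval Δ₀ ((D i).dir j) ∧
        sval Δ₀ ((D i).dir j) < dot ((D i).dir j) xv.1 + ε * dot ((D i).dir j) xv.2) ∧
      (D i).rhs - ∑ j, (D i).coef j * sval Δ₀ ((D i).dir j) <
        ε * ∑ j, max ((D i).coef j) 0 * rise pert ((D i).dir j) := by
  filter_upwards [linFamily_exists_failure hΔ hK pert hroom hxv₀ ht hv D hF, self_mem_nhdsWithin]
    with ε hε hpos
  have hε0 : (0 : ℝ) < ε := hpos
  obtain ⟨i, hi⟩ := hε
  exact ⟨i, hi, (D i).exists_nearlyTight_of_not_holds hΔ (hnec i) pert hx hε0.le hi,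
    (D i).slack_lt_of_not_holds hΔ pert hx hε0.le hi⟩

end AbstractFamilies

section K4Families

/-- the `K₄` perturbation set is the single exotic point -/
theorem pts_k4pert (ε : ℝ) : pts k4pert ε = {k4x0 + ε • k4tri} :=
  pts_singleton k4x0 k4tri ε

/-- the rise rate along the exotic direction is `⟨u,tri⟩⁺` -/
theorem rise_k4pert (u : Fin 6 → ℝ) : rise k4pert u = max (dot u k4tri) 0 := by
  simp [rise, k4pert]

/-- **the `K₄` update law**: `sval_ε u = max (sval₀ u) (⟨u,x₀⟩ + ε ⟨u,tri⟩)` — the whole effect of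
the exotic point on every weighted object, in one formula -/
theorem sval_k4pert {Δ₀ : Set (Fin 6 → ℝ)} (hΔ : Tame Δ₀) (ε : ℝ) (u : Fin 6 → ℝ) :
    sval (Δ₀ ∪ pts k4pert ε) u = max (sval Δ₀ u) (dot u k4x0 + ε * dot u k4tri) := by
  rw [pts_k4pert, sval_union_singleton hΔ, dot_add_smul]

/-- **Escape law for arbitrary families of multi-term pieces on `K₄` (critic g28, s2).**  `Δ₀` tame
in `K`, containing the six summit-face flattening points, room along `x₀ + ε·tri`.  If an ARBITRARY
family `(D i)_{i ∈ I}` of pieces `∑ j, coef_j · sval Δ u_j ≤ rhs`, each true at `Δ₀`, forces `ω ≤ 2`,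
then for every small `ε > 0` some member fails at `Δ₀ ∪ {x₀ + ε·tri}`, has a term with `coef_j > 0`,
`⟨u_j,tri⟩ > 0` (sees `ω`), `⟨u_j,x₀⟩ ≤ sval Δ₀ u_j < ⟨u_j,x₀⟩ + ε ⟨u_j,tri⟩` (`ε`-nearly tight), and
had slack `< ε · ∑ j coef_j⁺ ⟨u_j,tri⟩⁺`: infinite ω-free families escape only by accumulation. -/
theorem k4_linFamily_forces_nearly_tight {Δ₀ K : Set (Fin 6 → ℝ)} (hΔ : Tame Δ₀) (hK : Δ₀ ⊆ K)
    (hface : ∀ q ∈ k4face, q ∈ Δ₀) (hroom : ∀ᶠ ε in 𝓝[>] (0 : ℝ), k4x0 + ε • k4tri ∈ K)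
    {I : Type*} (D : I → LinData (Fin 6)) (hnec : ∀ i, (D i).holds Δ₀)
    (hF : ∀ Δ : Set (Fin 6 → ℝ), Δ₀ ⊆ Δ → Δ ⊆ K → (∀ i, (D i).holds Δ) → Cap k4tri 2 Δ) :
    ∀ᶠ ε in 𝓝[>] (0 : ℝ), ∃ i, ¬ (D i).holds (Δ₀ ∪ pts k4pert ε) ∧
      (∃ j, 0 < (D i).coef j ∧ 0 < dot ((D i).dir j) k4tri ∧
        dot ((D i).dir j) k4x0 ≤ sval Δ₀ ((D i).dir j) ∧
        sval Δ₀ ((D i).dir j) < dot ((D i).dir j) k4x0 + ε * dot ((D i).dir j) k4tri) ∧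
      (D i).rhs - ∑ j, (D i).coef j * sval Δ₀ ((D i).dir j) <
        ε * ∑ j, max ((D i).coef j) 0 * max (dot ((D i).dir j) k4tri) 0 := by
  have hroom' : ∀ xv ∈ k4pert, ∀ᶠ ε in 𝓝[>] (0 : ℝ), xv.1 + ε • xv.2 ∈ K := by
    intro xv hxv
    simp only [k4pert, List.mem_singleton] at hxv
    subst hxv
    exact hroom
  have hx : ∀ xv ∈ k4pert, ∀ u, dot u xv.1 ≤ sval Δ₀ u := by
    intro xv hxv u
    simp only [k4pert, List.mem_singleton] at hxv
    subst hxv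
    exact k4x0_dominated hΔ hface u
  have h := linFamily_forces_nearly_tight hΔ hK k4pert hroom' hx (xv₀ := (k4x0, k4tri))
    (by simp [k4pert]) dot_k4tri_x0 (by rw [dot_k4tri_tri]; norm_num) D hnec hF
  filter_upwards [h] with ε hε
  obtain ⟨i, hfail, ⟨xv, hxv, j, hj, hv, hdom, htight⟩, hslack⟩ := hε
  simp only [k4pert, List.mem_singleton] at hxv
  subst hxv
  refine ⟨i, hfail, ⟨j, hj, hv, hdom, htight⟩, ?_⟩
  simpa only [rise_k4pert] using hslack

end K4Families

/-! ### 11. The record cut is an equality cut at the flat world (critic g28, s1) -/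

section EqualityCut

/-- the slack of a support-linear piece at a world -/
noncomputable def LinData.slack (D : LinData (Fin 6)) (Δ : Set (Fin 6 → ℝ)) : ℝ :=
  D.rhs - ∑ j, D.coef j * sval Δ (D.dir j)

/-- slack of a two-term piece -/
theorem LinData.slack_two (c₁ c₂ r : ℝ) (u₁ u₂ : Fin 6 → ℝ) (Δ : Set (Fin 6 → ℝ)) :
    (⟨2, ![c₁, c₂], ![u₁, u₂], r⟩ : LinData (Fin 6)).slack Δ =
      r - (c₁ * sval Δ u₁ + c₂ * sval Δ u₂) := by
  change r - (∑ j : Fin 2, (![c₁, c₂] : Fin 2 → ℝ) j * sval Δ ((![u₁, u₂] : Fin 2 → Fin 6 → ℝ) j))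
    = _
  rw [Fin.sum_univ_two]
  simp only [Matrix.cons_val_zero, Matrix.cons_val_one]

/-- slack of a one-term piece -/
theorem LinData.slack_one (c r : ℝ) (u : Fin 6 → ℝ) (Δ : Set (Fin 6 → ℝ)) :
    (⟨1, ![c], ![u], r⟩ : LinData (Fin 6)).slack Δ = r - c * sval Δ u := by
  change r - (∑ j : Fin 1, (![c] : Fin 1 → ℝ) j * sval Δ ((![u] : Fin 1 → Fin 6 → ℝ) j)) = _
  rw [Fin.sum_univ_one]
  simp only [Matrix.cons_val_zero]

/-- `⟨𝟙,x₀⟩ = 7/2` -/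
theorem dot_k4one_x0 : dot k4one k4x0 = 7 / 2 := by rw [dot6]; simp [k4one, k4x0]; norm_num

/-- `⟨𝟙,tri⟩ = 3` -/
theorem dot_k4one_tri : dot k4one k4tri = 3 := by rw [dot6]; simp [k4one, k4tri]; norm_num

/-- `⟨(1,2,2,0,0,0),x₀⟩ = 10/3` -/
theorem dot_k4w122_x0 : dot k4w122 k4x0 = 10 / 3 := by rw [dot6]; simp [k4w122, k4x0]; norm_num

/-- `⟨(1,2,2,0,0,0),tri⟩ = 5` -/
theorem dot_k4w122_tri : dot k4w122 k4tri = 5 := by rw [dot6]; simp [k4w122, k4tri]; norm_num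

/-- `⟨(a,1,1,0,0,0),x₀⟩ = (2a+4)/3` -/
theorem dot_k4ua_x0 (a : ℝ) : dot (k4ua a) k4x0 = (2 * a + 4) / 3 := by
  rw [dot6]; simp [k4ua, k4x0]; ring

/-- `⟨(a,1,1,0,0,0),tri⟩ = a+2` -/
theorem dot_k4ua_tri (a : ℝ) : dot (k4ua a) k4tri = a + 2 := by rw [dot6]; simp [k4ua, k4tri]; ring

/-- `ω(2,1,2) = 4` in the flat world (attained at the star of vertex `2` and at the cut `f₁`) -/
theorem sval_k4flatSet_w122 : sval k4flatSet k4w122 = 4 := by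
  apply le_antisymm
  · apply sval_k4flatSet_le
    intro q hq
    simp only [k4flat, List.mem_cons, List.mem_nil_iff, or_false] at hq
    rcases hq with rfl | rfl | rfl | rfl | rfl | rfl | rfl <;>
      (rw [dot6]; simp [k4w122, k4s0, k4s1, k4s2, k4s3, k4f1, k4f2, k4f3]) <;> norm_num
  · have h := le_sval k4flatSet_tame k4w122 (show k4s2 ∈ k4flatSet by simp [k4flatSet, k4flat])
    have e : dot k4w122 k4s2 = 4 := by rw [dot6]; simp [k4w122, k4s2]; norm_num
    linarith

/-- `ω = 2` in the flat world -/
theorem sval_k4flatSet_tri : sval k4flatSet k4tri = 2 := by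
  apply le_antisymm
  · apply sval_k4flatSet_le
    intro q hq
    simp only [k4flat, List.mem_cons, List.mem_nil_iff, or_false] at hq
    rcases hq with rfl | rfl | rfl | rfl | rfl | rfl | rfl <;>
      (rw [dot6]; simp [k4tri, k4s0, k4s1, k4s2, k4s3, k4f1, k4f2, k4f3]) <;> norm_num
  · have h := le_sval k4flatSet_tame k4tri (show k4s0 ∈ k4flatSet by simp [k4flatSet, k4flat])
    have e : dot k4tri k4s0 = 2 := by rw [dot6]; simp [k4tri, k4s0]; norm_num
    linarith

/-- `ω(1,a,1) = 2` in the flat world (`a ≤ 1`): the value piece has slack `0` there -/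
theorem sval_k4flatSet_ua {a : ℝ} (ha : a ≤ 1) : sval k4flatSet (k4ua a) = 2 := by
  apply le_antisymm
  · exact (alphaCap_holds_iff a k4flatSet).1 (alphaCap_nec ha)
  · have h := le_sval k4flatSet_tame (k4ua a) (show k4s2 ∈ k4flatSet by simp [k4flatSet, k4flat])
    have e : dot (k4ua a) k4s2 = 2 := by rw [dot6]; simp [k4ua, k4s2]; norm_num
    linarith

/-- **The cut of record is an equality cut at the flat world (s1).**  At `Δ_flat` all three pieces
of `closes (hA : TetraExcessZero) (hB : TetraPlusTwo)` + the value piece `ω(1,a,1) ≤ 2` (`a ≤ 1`)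
hold with slack EXACTLY `0`: `ω(K₄) = ω(2,1,2) = 4`, `ω + 2 = ω(K₄)`, `ω(1,a,1) = 2`.  Piece slack
does not separate attacked from residual; the directional gap at the exotic point does
(`gap_flat_x0`). -/
theorem recordCut_slack_flat {a : ℝ} (ha : a ≤ 1) :
    excessZeroData.slack k4flatSet = 0 ∧ (residualPencilData 1).slack k4flatSet = 0 ∧
      (alphaCapData a).slack k4flatSet = 0 := by
  refine ⟨?_, ?_, ?_⟩
  · rw [show excessZeroData = ⟨2, ![1, -1], ![k4one, k4w122], 0⟩ from rfl, LinData.slack_two,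
      sval_k4flatSet_one, sval_k4flatSet_w122]
    norm_num
  · rw [show residualPencilData 1 = ⟨2, ![1, -1], ![k4tri, k4one], 2 * 1 - 4⟩ from rfl,
      LinData.slack_two, sval_k4flatSet_tri, sval_k4flatSet_one]
    norm_num
  · rw [show alphaCapData a = ⟨1, ![1], ![k4ua a], 2⟩ from rfl, LinData.slack_one,
      sval_k4flatSet_ua ha]
    norm_num

/-- **directional gaps at the exotic point** `sval Δ_flat u - ⟨u,x₀⟩`: `1/2` for `𝟙`, `2/3` for
`(1,2,2,0,0,0)`, `2(1-a)/3` for `(a,1,1,0,0,0)` (`→ 0` as `a → 1`), `0` for `tri` (TIGHT: the residual) -/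
theorem gap_flat_x0 {a : ℝ} (ha : a ≤ 1) :
    sval k4flatSet k4one - dot k4one k4x0 = 1 / 2 ∧
      sval k4flatSet k4w122 - dot k4w122 k4x0 = 2 / 3 ∧
      sval k4flatSet (k4ua a) - dot (k4ua a) k4x0 = 2 * (1 - a) / 3 ∧
      sval k4flatSet k4tri - dot k4tri k4x0 = 0 := by
  rw [sval_k4flatSet_one, dot_k4one_x0, sval_k4flatSet_w122, dot_k4w122_x0, sval_k4flatSet_ua ha,
    dot_k4ua_x0, sval_k4flatSet_tri, dot_k4tri_x0]
  norm_num
  ring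

/-- `TetraExcessZero` survives the exotic point for EVERY `ε` (not merely for small `ε > 0`):
`sval_ε 𝟙 = max 4 (7/2 + 3ε) ≤ max 4 (10/3 + 5ε) = sval_ε (1,2,2,0,0,0)` -/
theorem excessZero_holds_flat_pert (ε : ℝ) :
    excessZeroData.holds (k4flatSet ∪ pts k4pert ε) := by
  rw [excessZero_holds_iff, sval_k4pert k4flatSet_tame, sval_k4pert k4flatSet_tame,
    sval_k4flatSet_one, sval_k4flatSet_w122, dot_k4one_x0, dot_k4one_tri, dot_k4w122_x0,
    dot_k4w122_tri]
  rcases le_or_gt ε (1 / 12) with h | h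
  · rw [max_eq_left (show 7 / 2 + ε * 3 ≤ (4 : ℝ) by linarith)]
    exact le_max_left _ _
  · exact max_le_max le_rfl (by linarith)

/-- the value piece `ω(1,a,1) ≤ 2` (`a ≤ 1`) survives the exotic point iff
`ε (a+2) ≤ 2(1-a)/3`: its stability radius `2(1-a)/(3(a+2))` tends to `0` as `a → 1` — the
«accumulating tightness» of part 4b made exact -/
theorem alphaCap_holds_flat_pert_iff {a ε : ℝ} (ha : a ≤ 1) :
    (alphaCapData a).holds (k4flatSet ∪ pts k4pert ε) ↔ ε * (a + 2) ≤ 2 * (1 - a) / 3 := by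
  rw [alphaCap_holds_iff, sval_k4pert k4flatSet_tame, sval_k4flatSet_ua ha, dot_k4ua_x0,
    dot_k4ua_tri, max_le_iff]
  constructor
  · rintro ⟨-, h⟩
    linarith
  · intro h
    exact ⟨le_rfl, by linarith⟩

/-- `TetraPlusTwo` breaks at the exotic point for EVERY `ε > 0`:
`sval_ε tri + 2 = 4 + 3ε > max 4 (7/2 + 3ε) = sval_ε 𝟙` -/
theorem plusTwo_not_holds_flat_pert {ε : ℝ} (hε : 0 < ε) :
    ¬ (residualPencilData 1).holds (k4flatSet ∪ pts k4pert ε) := by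
  rw [plusTwo_holds_iff, sval_k4pert k4flatSet_tame, sval_k4pert k4flatSet_tame,
    sval_k4flatSet_tri, sval_k4flatSet_one, dot_k4tri_x0, dot_k4tri_tri, dot_k4one_x0,
    dot_k4one_tri, not_le, max_eq_right (show (2 : ℝ) ≤ 2 + ε * 3 by linarith), max_lt_iff]
  constructor <;> linarith

end EqualityCut

end Summit.MatrixMultiplication.MatrixMultiplication.Theorems.TetraResidualNecessity
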